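import Literature.AlgebraicGeometry.HodgeTheory.AlgebraicCechHolomorphicDeRhamAcyclicPieces
import Literature.AlgebraicGeometry.HodgeTheory.RegularFormRealizationBasicOpen
import Literature.Analysis.Complex.DolbeaultVanishingPolyhedra
import Literature.Geometry.Kaehler.DolbeaultAcyclicDeRhamVanishing
import HarnessLib

/-!
# `H^{p,q+1}_{∂̄} = 0` for the analytifications of basic open subschemes of affine space

[topic AlgebraicGeometry/HodgeTheory]

El Zein–Tu (Cattani–El Zein–Griffiths–Lê (2014), Ch. 2), §2.9.2: "a complex affine variety with the
complex topology is Stein", so that (Example 2.4.5, Cor. 2.5.3, Cartan's Theorem B) its Dolbeault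
cohomology vanishes in bidegrees `(p, ≥ 1)` — the binder of
`exists_isConjugateClass_of_rows_of_cartanB` (node G-N2b of Route P). This file discharges that binder
for the affine varieties `D(g) ⊆ 𝔸ⁿ_ℂ` (basic open subschemes of affine space, and finite intersections
of such) and everything isomorphic to them over `ℂ`, by the elementary route of
`Literature/Analysis/Complex/DolbeaultVanishingPolyhedra.lean`: the standard analytic model of `𝔸ⁿ_ℂ`
(`AnalyticModel.affineSpace`, carrier `ℂⁿ`) restricts over `D(g)` to the open piece
`{w ∈ ℂⁿ : g(w) ≠ 0}` (`AnalyticModel.coe_openSet_basicOpen`), the complement of the entire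
hypersurface `g = 0`, on which `H^{p,q+1}_{∂̄} = 0` by Oka's map
(`Literature.Analysis.Complex.subsingleton_dolbeaultCohomology_of_forall_ne_zero`; printed statement
Hörmander (1973), Cor. 4.2.6 for this domain of holomorphy); `∂̄`-acyclicity is independent of the model
(`AnalyticModel.subsingleton_dolbeaultCohomology_of_model`) and invariant under `ℂ`-isomorphisms
(`AnalyticModel.subsingleton_dolbeaultCohomology_of_iso`, by the functoriality `h ↦ h^an` of Serre,
GAGA §2 n°5).

* `AnalyticModel.subsingleton_dolbeaultCohomology_of_iso` — `Y' ≅ Y` over `ℂ`, `A` a model of `Y`,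
  `B` a model of `Y'`: `H^{p,q+1}_{∂̄}(A) = 0 → H^{p,q+1}_{∂̄}(B) = 0`;
* `AnalyticModel.differentiable_affineSpace_regularFun` — global functions of `𝔸ⁿ` read on `ℂⁿ` are
  entire;
* `subsingleton_dolbeaultCohomology_affineSpace_openSet` (open pieces of `ℂⁿ` of the shape
  `{g_i^an ≠ 0 ∀ i}`), `…_openSet_basicOpen` (`O = D(g)`), `…_openSet_iInf_basicOpen`
  (`O = ⋂ D(g_i)`);
* **`AnalyticModel.subsingleton_dolbeaultCohomology_of_iso_basicOpen`** — every analytic model (on any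
  model space `E`) of every smooth `ℂ`-scheme isomorphic over `ℂ` to some `𝔸ⁿ|_{D(g)}` is
  `∂̄`-acyclic in all bidegrees `(p,q+1)`;
* **`exists_isConjugateClass_of_rows_of_pieces_iso_basicOpen`** — Route P for a smooth projective
  `X` with a finite affine cover all of whose finite intersections are `ℂ`-isomorphic to basic opens of
  `𝔸ⁿ` (projective space with its standard cover: `U_{i₀} ∩ ⋯ ∩ U_{i_a} ≅ D(x_{i₁}⋯x_{i_a}) ⊆ 𝔸ⁿ`;
  Grassmannians, smooth projective toric varieties): `σ`-conjugate classes exist in every degree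
  GRANTED ONLY P3-rows (GAGA with Leray on the Čech rows) — the Theorem-B binder of
  `exists_isConjugateClass_of_rows_of_forall_subsingleton_dolbeaultCohomology` is discharged for such
  covers.

Everything is proved; theorems only; no named facts. NOT here: G-N2b for a general smooth affine `Y`
(closed submanifolds of `ℂ^N`: Cartan's Theorem B), P3-rows.

## References

* [CattaniElZeinGriffithsLe2014] E. Cattani, F. El Zein, P. Griffiths, Lê D. T. (eds.), *Hodge
  Theory* (2014), Ch. 2: Example 2.4.5, Cor. 2.5.3, §2.9.2.
* [HormanderSCV1973] L. Hörmander, *An Introduction to Complex Analysis in Several Variables* (1973),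
  Lemma 2.7.5, Thm. 2.7.8, Cor. 4.2.6.
* [SerreGAGA1956] J.-P. Serre, *Géométrie algébrique et géométrie analytique* (1956), §2 n°5.
* [Grothendieck1966] A. Grothendieck, *On the de Rham cohomology of algebraic varieties* (1966), p. 97.
-/

noncomputable section

universe u

open scoped Manifold ContDiff Topology
open Set Function CategoryTheory AlgebraicGeometry TopologicalSpace
open Literature.Algebra.Homology Literature.Geometry.Kaehler Literature.NumberTheory.Transcendental
open Literature.AlgebraicGeometry.Motives

namespace Literature.AlgebraicGeometry.HodgeTheory

/-! ### `∂̄`-acyclicity is invariant under `ℂ`-isomorphisms -/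

section Iso

variable {E₁ : Type} [NormedAddCommGroup E₁] [NormedSpace ℂ E₁] [FiniteDimensional ℂ E₁]
  {E₂ : Type} [NormedAddCommGroup E₂] [NormedSpace ℂ E₂] [FiniteDimensional ℂ E₂]
  {m m' : ℕ} {Y Y' : Motives.SchemeOver ℂ}
  [SmoothOfRelativeDimension m Y.hom] [SmoothOfRelativeDimension m' Y'.hom]

/-- **`H^{p,q+1}_∂̄ = 0` is invariant under `ℂ`-isomorphisms of smooth schemes**: for `e : Y' ≅ Y`, an
analytic model `A` of `Y` and an analytic model `B` of `Y'`, the analytified maps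
`(e.hom)^an : B → A`, `(e.inv)^an : A → B` are holomorphic and `(e.inv)^an ∘ (e.hom)^an = (𝟙)^an = id`
(functoriality of `X ↦ X^h`, Serre, GAGA §2 n°5; `AnalyticModel.anMap_comp_anMap`, `anMap_id`), so
vanishing of Dolbeault cohomology passes from `A` to `B`
(`Literature.Analysis.Complex.subsingleton_dolbeaultCohomology_of_leftInverse`).
[cite: SerreGAGA1956, §2 n°5] [cite: VoisinHodgeI2002, §7.3.2] -/
theorem AnalyticModel.subsingleton_dolbeaultCohomology_of_iso (e : Y' ≅ Y) (A : AnalyticModel E₁ m Y)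
    (B : AnalyticModel E₂ m' Y') {p q : ℕ}
    (hA : Subsingleton (dolbeaultCohomology E₁ A.carrier p (q + 1))) :
    Subsingleton (dolbeaultCohomology E₂ B.carrier p (q + 1)) :=
  Literature.Analysis.Complex.subsingleton_dolbeaultCohomology_of_leftInverse
    (f := B.anMap A e.hom) (g := A.anMap B e.inv)
    (B.mdifferentiable_anMap A e.hom) (B.contMDiff_anMap A e.hom)
    (A.mdifferentiable_anMap B e.inv) (A.contMDiff_anMap B e.inv)
    (fun z ↦ by
      have h := congrFun (B.anMap_comp_anMap A B e.hom e.inv) z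
      rwa [e.hom_inv_id, B.anMap_id] at h) hA

end Iso

/-! ### The standard model of `𝔸ⁿ_ℂ`: open pieces that are complements of hypersurfaces -/

section AffineSpace

variable (n : ℕ)

/-- **Global functions of `𝔸ⁿ_ℂ` read on the standard model `ℂⁿ` are entire** (they are polynomial
functions: Serre, GAGA §2 n°5 Lemme 1 c); the tree's
`ComplexPoints.differentiableOn_evalOrZero_affinePoint` on the open `⊤`).
[cite: SerreGAGA1956, §2 n°5 Lemme 1] -/
theorem AnalyticModel.differentiable_affineSpace_regularFun
    (s : Γ((affineSpaceOver (Fin n) ℂ).left, ⊤)) :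
    Differentiable ℂ (fun w : Fin n → ℂ ↦ (AnalyticModel.affineSpace n).regularFun s w) := by
  have h := Motives.ComplexPoints.differentiableOn_evalOrZero_affinePoint n ⊤ s
  have huniv : {w : Fin n → ℂ | (Motives.AlgPoints.affinePoint ℂ w).pt ∈
      (⊤ : (𝔸(Fin n; Spec (.of ℂ))).Opens)} = univ :=
    eq_univ_of_forall fun _ ↦ Opens.mem_top _
  rw [huniv, differentiableOn_univ] at h
  exact h

/-- **`H^{p,q+1}_∂̄ = 0` on the open pieces `{w ∈ ℂⁿ : g_i(w) ≠ 0 ∀ i}` of the standard model of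
`𝔸ⁿ_ℂ`**: if the open piece `ψ⁻¹(O(ℂ)) ⊆ ℂⁿ` over a Zariski open `O ⊆ 𝔸ⁿ` is cut out by finitely many
global functions `g_i` (as it is for `O = D(g)`, `O = ⋂ D(g_i)`), its Dolbeault cohomology vanishes in
all bidegrees `(p,q+1)` — the complement of the entire hypersurfaces `g_i^an = 0` in `ℂⁿ`
(`Literature.Analysis.Complex.subsingleton_dolbeaultCohomology_of_forall_ne_zero`, Oka's map;
Hörmander (1973), Cor. 4.2.6 for this domain of holomorphy). [cite: HormanderSCV1973, Cor. 4.2.6] -/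
theorem subsingleton_dolbeaultCohomology_affineSpace_openSet {k : ℕ}
    (g : Fin k → Γ((affineSpaceOver (Fin n) ℂ).left, ⊤)) (O : (affineSpaceOver (Fin n) ℂ).left.Opens)
    (hO : ((AnalyticModel.affineSpace n).openSet O : Set (AnalyticModel.affineSpace n).carrier) =
      {w | ∀ i, (AnalyticModel.affineSpace n).regularFun (g i) w ≠ 0}) (p q : ℕ) :
    Subsingleton (dolbeaultCohomology (Fin n → ℂ) ((AnalyticModel.affineSpace n).openSet O) p (q + 1)) :=
  Literature.Analysis.Complex.subsingleton_dolbeaultCohomology_of_forall_ne_zero (ι := Fin n)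
    (fun i (w : Fin n → ℂ) ↦ (AnalyticModel.affineSpace n).regularFun (g i) w)
    (fun i ↦ AnalyticModel.differentiable_affineSpace_regularFun n (g i))
    ((AnalyticModel.affineSpace n).openSet O) hO p q

/-- **`H^{p,q+1}_∂̄(D(g)^an) = 0`** for the open piece `{w ∈ ℂⁿ : g(w) ≠ 0}` of the standard model of
`𝔸ⁿ_ℂ` over a basic open `D(g)` (`AnalyticModel.coe_openSet_basicOpen`).
[cite: HormanderSCV1973, Cor. 4.2.6] -/
theorem subsingleton_dolbeaultCohomology_affineSpace_openSet_basicOpen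
    (g : Γ((affineSpaceOver (Fin n) ℂ).left, ⊤)) (p q : ℕ) :
    Subsingleton (dolbeaultCohomology (Fin n → ℂ)
      ((AnalyticModel.affineSpace n).openSet ((affineSpaceOver (Fin n) ℂ).left.basicOpen g)) p (q + 1)) :=
  subsingleton_dolbeaultCohomology_affineSpace_openSet n (k := 1) (fun _ ↦ g) _
    (by
      rw [AnalyticModel.coe_openSet_basicOpen]
      ext w
      simp) p q

/-- **`H^{p,q+1}_∂̄((D(g₁) ∩ ⋯ ∩ D(g_k))^an) = 0`** for the open piece of the standard model of `𝔸ⁿ_ℂ`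
over a finite intersection of basic opens. [cite: HormanderSCV1973, Cor. 4.2.6] -/
theorem subsingleton_dolbeaultCohomology_affineSpace_openSet_iInf_basicOpen {k : ℕ}
    (g : Fin k → Γ((affineSpaceOver (Fin n) ℂ).left, ⊤)) (p q : ℕ) :
    Subsingleton (dolbeaultCohomology (Fin n → ℂ)
      ((AnalyticModel.affineSpace n).openSet (⨅ i, (affineSpaceOver (Fin n) ℂ).left.basicOpen (g i)))
        p (q + 1)) := by
  refine subsingleton_dolbeaultCohomology_affineSpace_openSet n g _ ?_ p q
  ext w
  rw [SetLike.mem_coe, AnalyticModel.mem_openSet_iff, ← SetLike.mem_coe, Opens.coe_iInf, mem_iInter,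
    mem_setOf_eq]
  refine forall_congr' fun i ↦ ?_
  rw [SetLike.mem_coe, ← AnalyticModel.mem_openSet_iff]
  exact (AnalyticModel.affineSpace n).mem_openSet_basicOpen_iff (g i) w

end AffineSpace

/-! ### Every model of a `ℂ`-scheme isomorphic to a basic open of affine space -/

section Models

variable {E : Type} [NormedAddCommGroup E] [NormedSpace ℂ E] [FiniteDimensional ℂ E]
  {n m : ℕ} {Y : Motives.SchemeOver ℂ} [SmoothOfRelativeDimension m Y.hom]

/-- **Every analytic model of a smooth `ℂ`-scheme isomorphic over `ℂ` to a basic open `𝔸ⁿ|_{D(g)}` of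
affine space is `∂̄`-acyclic**: `H^{p,q+1}_∂̄(B) = 0` for all `p, q` — from the open piece
`{g^an ≠ 0} ⊆ ℂⁿ` of the standard model (`subsingleton_dolbeaultCohomology_affineSpace_openSet_basicOpen`,
the carrier of `(AnalyticModel.affineSpace n).restrictOpen D(g)`), transported along the isomorphism
(`AnalyticModel.subsingleton_dolbeaultCohomology_of_iso`). This is the Theorem-B binder of
`exists_isConjugateClass_of_rows_of_cartanB` (El Zein–Tu §2.9.2: "a complex affine variety with the
complex topology is Stein") for these affine varieties.
[cite: CattaniElZeinGriffithsLe2014, Ch. 2 §2.9.2 + Ex. 2.4.5] [cite: HormanderSCV1973, Cor. 4.2.6] -/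
theorem AnalyticModel.subsingleton_dolbeaultCohomology_of_iso_basicOpen
    (g : Γ((affineSpaceOver (Fin n) ℂ).left, ⊤))
    (e : Y ≅ Motives.openSubschemeOver (affineSpaceOver (Fin n) ℂ)
      ((affineSpaceOver (Fin n) ℂ).left.basicOpen g))
    (B : AnalyticModel E m Y) (p q : ℕ) :
    Subsingleton (dolbeaultCohomology E B.carrier p (q + 1)) :=
  AnalyticModel.subsingleton_dolbeaultCohomology_of_iso e
    ((AnalyticModel.affineSpace n).restrictOpen ((affineSpaceOver (Fin n) ℂ).left.basicOpen g)) B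
    (subsingleton_dolbeaultCohomology_affineSpace_openSet_basicOpen n g p q)

/-- The same for a finite intersection of basic opens `𝔸ⁿ|_{D(g₁) ∩ ⋯ ∩ D(g_k)}`.
[cite: CattaniElZeinGriffithsLe2014, Ch. 2 §2.9.2 + Ex. 2.4.5] [cite: HormanderSCV1973, Cor. 4.2.6] -/
theorem AnalyticModel.subsingleton_dolbeaultCohomology_of_iso_iInf_basicOpen {k : ℕ}
    (g : Fin k → Γ((affineSpaceOver (Fin n) ℂ).left, ⊤))
    (e : Y ≅ Motives.openSubschemeOver (affineSpaceOver (Fin n) ℂ)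
      (⨅ i, (affineSpaceOver (Fin n) ℂ).left.basicOpen (g i)))
    (B : AnalyticModel E m Y) (p q : ℕ) :
    Subsingleton (dolbeaultCohomology E B.carrier p (q + 1)) :=
  AnalyticModel.subsingleton_dolbeaultCohomology_of_iso e
    ((AnalyticModel.affineSpace n).restrictOpen (⨅ i, (affineSpaceOver (Fin n) ℂ).left.basicOpen (g i))) B
    (subsingleton_dolbeaultCohomology_affineSpace_openSet_iInf_basicOpen n g p q)

/-- In particular every analytic model of `𝔸ⁿ|_{D(g)}` itself is `∂̄`-acyclic.
[cite: CattaniElZeinGriffithsLe2014, Ch. 2 §2.9.2 + Ex. 2.4.5] [cite: HormanderSCV1973, Cor. 4.2.6] -/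
theorem AnalyticModel.subsingleton_dolbeaultCohomology_basicOpen (g : Γ((affineSpaceOver (Fin n) ℂ).left, ⊤))
    (B : AnalyticModel E n (Motives.openSubschemeOver (affineSpaceOver (Fin n) ℂ)
      ((affineSpaceOver (Fin n) ℂ).left.basicOpen g))) (p q : ℕ) :
    Subsingleton (dolbeaultCohomology E B.carrier p (q + 1)) :=
  AnalyticModel.subsingleton_dolbeaultCohomology_of_iso_basicOpen g (Iso.refl _) B p q

/-- And every analytic model of `𝔸ⁿ` itself (`O = D(1) = ⊤` is not needed: transport from the
standard model `ℂⁿ`, where `H^{p,q+1}_∂̄(ℂⁿ) = 0` is the case of no hypersurface).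
[cite: HormanderSCV1973, Thm. 2.7.8] -/
theorem AnalyticModel.subsingleton_dolbeaultCohomology_affineSpaceOver
    (B : AnalyticModel E n (affineSpaceOver (Fin n) ℂ)) (p q : ℕ) :
    Subsingleton (dolbeaultCohomology E B.carrier p (q + 1)) := by
  have h0 : Subsingleton (dolbeaultCohomology (Fin n → ℂ)
      ((AnalyticModel.affineSpace n).openSet ⊤) p (q + 1)) :=
    subsingleton_dolbeaultCohomology_affineSpace_openSet n (k := 0) Fin.elim0 ⊤
      (by ext w; simp [AnalyticModel.mem_openSet_iff]) p q
  -- `𝔸ⁿ|_⊤ ≅ 𝔸ⁿ` over `ℂ` (`Scheme.topIso`)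
  let e : Motives.openSubschemeOver (affineSpaceOver (Fin n) ℂ) ⊤ ≅ affineSpaceOver (Fin n) ℂ :=
    Over.isoMk (affineSpaceOver (Fin n) ℂ).left.topIso (by simp [Motives.openSubschemeOver]; rfl)
  exact AnalyticModel.subsingleton_dolbeaultCohomology_of_iso e.symm
    ((AnalyticModel.affineSpace n).restrictOpen ⊤) B h0

end Models

/-! ### Route P for covers by basic opens of affine space -/

section RouteP

variable {E : Type} [NormedAddCommGroup E] [NormedSpace ℂ E] [FiniteDimensional ℂ E]

/-- **Conjugate classes from GAGA on the rows, for covers whose pieces are basic opens of affine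
space.** Let `X` be smooth projective of dimension `n` over `ℂ` with a finite affine open cover `𝔘`
(charts `C`, analytic model `A`) such that every finite intersection `X|_{U_J}` is `ℂ`-isomorphic to a
basic open `𝔸ⁿ|_{D(g_J)}` of affine space — e.g. projective space with its standard cover
(`U_{i₀} ∩ ⋯ ∩ U_{i_a} ≅ D(∏ x_{i_k/i₀})`), Grassmannians, smooth projective toric varieties. If the
realisation `C•(𝔘, Ω^q_alg) → C•(𝔘^an, Ω^q_hol)` is a quasi-isomorphism for every `q` (P3-rows: GAGA
with Leray on both sides), then for every `σ ∈ Aut ℂ`, every `k` and every `c ∈ Hᵏ(X(ℂ); ℂ)` there is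
a class on `X^σ` conjugate to `c`: the Theorem-B binder of
`exists_isConjugateClass_of_rows_of_forall_subsingleton_dolbeaultCohomology` holds for the pieces by
`AnalyticModel.subsingleton_dolbeaultCohomology_of_iso_basicOpen` applied to the restricted models
`A.restrictOpen (cechOpen U J)` (carrier the open piece `ψ⁻¹U_J(ℂ)`).
[cite: Grothendieck1966, p. 97] [cite: CattaniElZeinGriffithsLe2014, Ch. 2 §2.9.2 + Cor. 2.5.3]
[cite: HormanderSCV1973, Cor. 4.2.6] -/
theorem exists_isConjugateClass_of_rows_of_pieces_iso_basicOpen {n : ℕ}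
    {X : Motives.SchemeOver ℂ} {ι : Type u} {U : ι → X.left.Opens} (hX : Motives.IsSmoothProjective n X)
    [Fintype ι] [IsAffineCover U] (hU : ⨆ i, U i = ⊤) (C : CoverCharts X U) (A : AnalyticModel E n X)
    (hrows : haveI : SmoothOfRelativeDimension n X.hom := hX.smoothOfRelativeDimension
      ∀ q a, Bijective (NatCochain.Cohomology.map (d := fun i ↦ C.cechDeRhamℝ.δ i q)
        (d' := fun i ↦ (cechHolDeRham E A.carrier (A.isOpen_coverSet U)).δ i q)
        (fun i ↦ (C.realizeHolHom A).f i q) (fun i c ↦ (C.realizeHolHom A).f_δ i q c) a))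
    (hpieces : ∀ {a : ℕ} (J : Fin (a + 1) → ι), ∃ g : Γ((affineSpaceOver (Fin n) ℂ).left, ⊤),
      Nonempty (cechScheme X U J ≅ Motives.openSubschemeOver (affineSpaceOver (Fin n) ℂ)
        ((affineSpaceOver (Fin n) ℂ).left.basicOpen g)))
    (k : ℕ) (σ : ℂ ≃+* ℂ) (c : complexBetti X k) : ∃ c', IsConjugateClass σ X k c c' := by
  haveI : SmoothOfRelativeDimension n X.hom := hX.smoothOfRelativeDimension
  refine exists_isConjugateClass_of_rows_of_forall_subsingleton_dolbeaultCohomology hX hU C A hrows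
    (fun J p q ↦ ?_) k σ c
  obtain ⟨g, ⟨e⟩⟩ := hpieces J
  exact AnalyticModel.subsingleton_dolbeaultCohomology_of_iso_basicOpen g e
    (A.restrictOpen (cechOpen U J)) p q

end RouteP

end Literature.AlgebraicGeometry.HodgeTheory

/-! ### De Rham cohomology above the dimension for models of basic opens

(Add-only rider.) Hörmander (1973), Thm. 5.2.7 ("If `Ω` is a Stein manifold of dimension `n`, then
`Hʳ(Ω, ℂ) = 0` when `r > n`") for the Stein manifolds `Y^an`, `Y ≅_ℂ 𝔸ⁿ|_{D(g)}`, in the tree's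
smooth-forms de Rham cohomology: `Literature.Geometry.Kaehler.subsingleton_complexDeRhamCohomology_of_forall_subsingleton_dolbeaultCohomology`
(Thm. 2.7.10: holomorphic representatives of type `(r,0)` vanish for `r > n`) fed with the
`∂̄`-acyclicity of this file, transported along `ℂ`-isomorphisms. -/

namespace Literature.AlgebraicGeometry.HodgeTheory

section IsoDeRham

variable {E₁ : Type} [NormedAddCommGroup E₁] [NormedSpace ℂ E₁] [FiniteDimensional ℂ E₁]
  {E₂ : Type} [NormedAddCommGroup E₂] [NormedSpace ℂ E₂] [FiniteDimensional ℂ E₂]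
  {m m' : ℕ} {Y Y' : Motives.SchemeOver ℂ}
  [SmoothOfRelativeDimension m Y.hom] [SmoothOfRelativeDimension m' Y'.hom]

/-- `((e.hom)^an)^* ∘ ((e.inv)^an)^* = id` on `Hʳ_dR(B; ℂ)` for `e : Y' ≅ Y`, `B` a model of `Y'`, `A` a
model of `Y` (functoriality of `X ↦ X^h` and of `f^*`). [cite: SerreGAGA1956, §2 n°5] [cite: BottTu1982Forms, §I.2] -/
theorem AnalyticModel.map_anMap_hom_map_anMap_inv (e : Y' ≅ Y) (A : AnalyticModel E₁ m Y)
    (B : AnalyticModel E₂ m' Y') (r : ℕ) (c : complexDeRhamCohomology E₂ B.carrier r) :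
    complexDeRhamCohomology.map E₂ (B.contMDiff_anMap A e.hom) r
      (complexDeRhamCohomology.map E₁ (A.contMDiff_anMap B e.inv) r c) = c := by
  obtain ⟨α, rfl⟩ := complexDeRhamCohomology.mk_surjective c
  rw [complexDeRhamCohomology.map_mk, complexDeRhamCohomology.map_mk]
  congr 1
  refine Subtype.ext ?_
  change ((α : MForm 𝓘(ℝ, E₂) B.carrier ℂ r).pullback 𝓘(ℝ, E₁) (A.anMap B e.inv)).pullback 𝓘(ℝ, E₂)
    (B.anMap A e.hom) = (α : MForm 𝓘(ℝ, E₂) B.carrier ℂ r)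
  have hcomp : A.anMap B e.inv ∘ B.anMap A e.hom = id := by
    rw [B.anMap_comp_anMap A B e.hom e.inv, e.hom_inv_id, B.anMap_id]
  rw [← MForm.pullback_comp ((A.contMDiff_anMap B e.inv).mdifferentiable (by simp))
    ((B.contMDiff_anMap A e.hom).mdifferentiable (by simp)), hcomp, MForm.pullback_id]

/-- **`Hʳ_dR = 0` is invariant under `ℂ`-isomorphisms of smooth schemes** (any models, any model
spaces): `c = ((e.hom)^an)^* ((e.inv)^an)^* c` and `Hʳ_dR(A; ℂ) = 0`.
[cite: SerreGAGA1956, §2 n°5] [cite: BottTu1982Forms, §I.2] -/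
theorem AnalyticModel.subsingleton_complexDeRhamCohomology_of_iso (e : Y' ≅ Y) (A : AnalyticModel E₁ m Y)
    (B : AnalyticModel E₂ m' Y') {r : ℕ}
    (hA : Subsingleton (complexDeRhamCohomology E₁ A.carrier r)) :
    Subsingleton (complexDeRhamCohomology E₂ B.carrier r) := by
  refine ⟨fun c₁ c₂ => ?_⟩
  rw [← AnalyticModel.map_anMap_hom_map_anMap_inv e A B r c₁,
    ← AnalyticModel.map_anMap_hom_map_anMap_inv e A B r c₂,
    Subsingleton.elim (complexDeRhamCohomology.map E₁ (A.contMDiff_anMap B e.inv) r c₁)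
      (complexDeRhamCohomology.map E₁ (A.contMDiff_anMap B e.inv) r c₂)]

end IsoDeRham

section DeRhamVanishing

variable {E : Type} [NormedAddCommGroup E] [NormedSpace ℂ E] [FiniteDimensional ℂ E]
  {n m : ℕ} {Y : Motives.SchemeOver ℂ} [SmoothOfRelativeDimension m Y.hom]

/-- **`Hʳ_dR(Y^an; ℂ) = 0` for `r > n` and every analytic model of a smooth `ℂ`-scheme `Y ≅_ℂ 𝔸ⁿ|_{D(g)}`**
(Hörmander (1973), Thm. 5.2.7 for the Stein manifold `Y^an` — e.g. `Hʳ((ℂ^*)^n; ℂ) = 0` for `r > n`):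
the open piece `{g^an ≠ 0} ⊆ ℂⁿ` of the standard model is `∂̄`-acyclic
(`subsingleton_dolbeaultCohomology_affineSpace_openSet_basicOpen`), so its de Rham cohomology
vanishes above `n = dim_ℂ ℂⁿ`
(`Literature.Geometry.Kaehler.subsingleton_complexDeRhamCohomology_of_forall_subsingleton_dolbeaultCohomology`),
and this is transported along `e` (`AnalyticModel.subsingleton_complexDeRhamCohomology_of_iso`).
[cite: HormanderSCV1973, Thm. 5.2.7] -/
theorem AnalyticModel.subsingleton_complexDeRhamCohomology_of_iso_basicOpen
    (g : Γ((affineSpaceOver (Fin n) ℂ).left, ⊤))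
    (e : Y ≅ Motives.openSubschemeOver (affineSpaceOver (Fin n) ℂ)
      ((affineSpaceOver (Fin n) ℂ).left.basicOpen g))
    (B : AnalyticModel E m Y) {r : ℕ} (hr : n < r) :
    Subsingleton (complexDeRhamCohomology E B.carrier r) := by
  have h0 : Subsingleton (complexDeRhamCohomology (Fin n → ℂ)
      ((AnalyticModel.affineSpace n).restrictOpen ((affineSpaceOver (Fin n) ℂ).left.basicOpen g)).carrier r) :=
    Literature.Geometry.Kaehler.subsingleton_complexDeRhamCohomology_of_forall_subsingleton_dolbeaultCohomology
      (fun p q ↦ subsingleton_dolbeaultCohomology_affineSpace_openSet_basicOpen n g p q)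
      (by simpa using hr)
  exact AnalyticModel.subsingleton_complexDeRhamCohomology_of_iso e _ B h0

/-- In particular for every analytic model of `𝔸ⁿ|_{D(g)}` itself. [cite: HormanderSCV1973, Thm. 5.2.7] -/
theorem AnalyticModel.subsingleton_complexDeRhamCohomology_basicOpen
    (g : Γ((affineSpaceOver (Fin n) ℂ).left, ⊤))
    (B : AnalyticModel E n (Motives.openSubschemeOver (affineSpaceOver (Fin n) ℂ)
      ((affineSpaceOver (Fin n) ℂ).left.basicOpen g))) {r : ℕ} (hr : n < r) :
    Subsingleton (complexDeRhamCohomology E B.carrier r) :=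
  AnalyticModel.subsingleton_complexDeRhamCohomology_of_iso_basicOpen g (Iso.refl _) B hr

end DeRhamVanishing

end Literature.AlgebraicGeometry.HodgeTheory

end
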